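import Summits.QuantumFields.BalabanUV.Beta.FP.GaugeFactorRowDiffSocket
import Summits.QuantumFields.BalabanUV.Beta.FP.FreeBiResolventRowDiff
import Summits.QuantumFields.BalabanUV.Beta.FP.CovarianceRowSumTower
import Summits.QuantumFields.BalabanUV.Beta.FP.CovarianceRowDiffTower

/-!
# `BalabanUV.Beta.FP.CovarianceRowDiffGauge` — road «FP» (binder row D1), lane IR-5′, FILE C of the `hAB` plan: **THE COMPOSITE GAUGE LETTER `hAB` IS A
# THEOREM, WITH THE EXACT POWER** — `∃ ab, ∀` tower torus `P` (`n = L^K`, `M_ν = 2L^m`), `∀ ν i`, `Σ_j ‖((S_ν − 1)·(∂Δ⁻¹R)(RΔ⁻¹∂ᴴ)) i j‖ ≤ ab ∕ n` —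
# hence g22's (T1′) SOCKET closes: the column-difference Γ-letter (T1′) and the (R1) gauge term's `hR1′`, `hR2` are UNCONDITIONAL

HONEST DEPENDENCY (page 1, mandatory): continuum YM on T⁴ ⇐ BetaPertH ∧ nine spine estimates (0/9 proved); BetaPertH ⇐ (D1) ∧ (D4) ∧
CAP+tail; G-an2-4 gates asym, D1 and NE2/3/4.  HONEST FRAMING (cell contract, verbatim): «discharging `BetaPertH` makes Bałaban's UV
stability UNCONDITIONAL — a real constructive-QFT result; it is NOT the continuum limit and NOT the Clay problem.»  THIS MODULE is bookkeeping BY NAME: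
FILE A `GaugeFactorRowDiffSocket.rowSum_shift_gaugeFactor_le` (the socket: `hAB ⟸ φ₂, φ₃, cG′, cC, cD`), FILE B `FreeBiResolventRowDiff.rowSum_shift_grad_biResolvent_le`
∕ `…_gradH_le` (the FREE letters `φ₂ ≤ C²∕n`, `φ₃ ≤ (d+1)C³((2∕3)^{−1∕2})³Γ(½)∕n`, `C = 1260·48^{d+1}`, cubic torus), file 7 `CovarianceRowSumTower`
(`exists_rowSum_towerG`, `exists_rowSum_towerG_derivT`, `rowSum_Gp_eq`, `rowSum_GradOp_Gp_eq`, `rowSum_Gp_GradOpH_eq`: the scalar `G′` letters on the tower,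
read off lit-balaban's B4 ∕ B5 torus theorems), file 5 `CoarseSandwichInverseRowSum.exists_rowSum_QGGQ_inv_le` (`cC`), and F5e `CovarianceRowDiffTower`'s three
`…_of_gaugeLetter` ENDs.  It cites nothing as a hypothesis, mints no `Prop`, has no `def`, 0 sorry.  WHAT IT IS NOT: NOT hslice, NOT (ASYMP), NOT SDF,
NOT D1, NOT BetaPertH, NOT continuum, NOT Clay; the (R1) gauge term is ONE term of the road's remainder bookkeeping (RHOA-3), nothing more.

ABSOLUTE RULE (cell charter, verbatim): «No internally-minted statement may enter as a cited fact. Every hypothesis is either kernel-proved in this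
package or a verbatim quotation of a PUBLISHED theorem with page reference. The manuscript(s) under audit are NOT citable for their own disputed
steps — they are the thing under adjudication; programme-internal (2001/route/tribunal) claims are never citable.»

CONTENT.  §1 **`gaugeLetter_holds`** (`hAB`, every `d`, odd `L > 1`): at each tower volume the running constant `b = α P a P.K ∈ [a(1−L⁻²), a]` (`a = 1`) feeds
FILE A with file 7's `cG′ = C₁`, `cD = (d+1)C₂`, file 5's `cC`, and FILE B's `φ₂ φ₃` (the cubic torus `Tor (fine (L^K) (2L^m)) = Tor (fun _ ↦ L^K·2L^m)`
definitionally); the bound is monotone in `b ≤ a`, giving one `ab(d, L)`.  §2 (`d = 3`) THE (T1′) SOCKET CLOSED: **`sum_abs_KPerf_ff_colDiff_le`** ((T1′):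
`Σ_{q∈Q}|KPerf Lc … m q (w+e_μ) (inl κ)(inl l) − KPerf … m q w (inl κ)(inl l)| ≤ A₁·Lc^m`), **`exists_abs_rho_road_sub_right_le`** (hR1′ `≤ B₁′∕((Lc)^m)³`),
**`exists_abs_rho_road_sub_sub_le`** (hR2 `≤ B₂∕((Lc)^m)⁴`) — UNCONDITIONAL for odd `Lc > 1`.
Unit `b2b-balaban-beta-d1-formalise-leaf-05` (gen 23), 2026-08-21; `LEAVES-FP.md` row «(T1′) SOCKET» (plan `HOME/…/leaf-05/g23/hAB-PLAN.md` v2).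
«not in print; our proof» (B5 prints (1.115) for `G` and (1.44) ∕ (1.126) for `R`, `P`; the composite letter, the bi-resolvent comparison and the heat-kernel route are ours).
-/

noncomputable section

open scoped BigOperators Matrix ComplexConjugate

namespace Summit.QuantumFields.BalabanUV.Beta.FP.CovarianceRowDiffGauge

open Literature.Probability.LatticeModels (latticeGreen)
open Literature.MathematicalPhysics.QuantumFieldTheory.Balaban1983to89
open Literature.MathematicalPhysics.QuantumFieldTheory.Balaban1983to89.Beta
open Literature.MathematicalPhysics.QuantumFieldTheory.Balaban1983to89.Beta.DyadicShell (Pt)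
open Literature.MathematicalPhysics.QuantumFieldTheory.Balaban1983to89.B5Prop11Plancherel (Tor fine shiftM unitVec)
open Literature.MathematicalPhysics.QuantumFieldTheory.Balaban1983to89.B5Action121 (GradOp LapS)
open Literature.MathematicalPhysics.QuantumFieldTheory.Balaban1983to89.B5Block118 (QsOp)
open Literature.MathematicalPhysics.QuantumFieldTheory.Balaban1983to89.B5Hk160Torus (QsAdj)
open Literature.MathematicalPhysics.QuantumFieldTheory.Balaban1983to89.B5LaplaceInverse (LapSinv)
open Literature.MathematicalPhysics.QuantumFieldTheory.Balaban1983to89.B5Identities197Torus (RT)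
open Literature.MathematicalPhysics.QuantumFieldTheory.Balaban1983to89.B4TorusKernel (periodConst)
open Literature.MathematicalPhysics.QuantumFieldTheory.Balaban1983to89.B4Sect5Proof (latticeConst)
open Literature.MathematicalPhysics.QuantumFieldTheory.Balaban1983to89.B5SiteBridgeP12 (nP MP eFine one_le_nP)
open Literature.MathematicalPhysics.QuantumFieldTheory.Balaban1983to89.B1RG242Torus (deriv tower α)
open Summit.QuantumFields.BalabanUV.Beta.GAN24.CombesThomas (sfStep smStep)
open Summit.QuantumFields.BalabanUV.Beta.FP.PerfectObjectsT (KPerf)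
open Summit.QuantumFields.BalabanUV.Beta.FP.SliceProjectorKernel (piC)
open Summit.QuantumFields.BalabanUV.Beta.FP.CovarianceRowSum (rowSum_nonneg_of_le)
open Summit.QuantumFields.BalabanUV.Beta.FP.CovarianceRowSumTower (exists_rowSum_towerG exists_rowSum_towerG_derivT rowSum_Gp_eq rowSum_GradOp_Gp_eq rowSum_Gp_GradOpH_eq)
open Summit.QuantumFields.BalabanUV.Beta.FP.CoarseSandwichInverseRowSum (exists_rowSum_QGGQ_inv_le)
open Summit.QuantumFields.BalabanUV.Beta.FP.ScalarTowerBridge (α_top aSeq_bounds)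
open Summit.QuantumFields.BalabanUV.Beta.FP.GaugeFactorRowDiffSocket (rowSum_shift_gaugeFactor_le)
open Summit.QuantumFields.BalabanUV.Beta.FP.FreeBiResolventRowDiff (rowSum_shift_grad_biResolvent_le rowSum_shift_grad_biResolvent_gradH_le)
open Summit.QuantumFields.BalabanUV.Beta.FP.CovarianceRowDiffTower (sum_abs_KPerf_ff_colDiff_le_of_gaugeLetter exists_abs_rho_road_sub_right_le_of_gaugeLetter
  exists_abs_rho_road_sub_sub_le_of_gaugeLetter)

/-! ## §1 The composite gauge letter `hAB` -/

/-- [our proof] **THE COMPOSITE GAUGE LETTER `hAB`, EXACT POWER**: for every `d` and odd `L > 1` there is `ab(d, L)` with, for every tower volume `P`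
(`P.d = d+1`, `P.L = L`, `P.K ≥ 1`; fine torus `Tor (fine (L^K) (2L^m))`), every direction `ν` and row `i`,
`Σ_j ‖((S_ν − 1)·(∂Δ⁻¹R)(RΔ⁻¹∂ᴴ)) i j‖ ≤ ab ∕ L^K` — FILE A's socket fed with file 7's ∕ file 5's scalar letters and FILE B's two free letters. -/
theorem gaugeLetter_holds (d L : ℕ) (hL : Odd L ∧ 1 < L) :
    ∃ ab : ℝ, ∀ P : Params, P.d = d + 1 → P.L = L → 1 ≤ P.K →
      ∀ (ν : Fin P.d) (i : Tor (fine (nP P) (MP P)) × Fin P.d),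
        ∑ j, ‖((shiftM (fine (nP P) (MP P)) ν - 1) *
          ((GradOp (fine (nP P) (MP P)) (nP P : ℂ) * LapSinv (fine (nP P) (MP P)) (nP P : ℂ) * RT (nP P) (MP P))
            * (RT (nP P) (MP P) * LapSinv (fine (nP P) (MP P)) (nP P : ℂ) * (GradOp (fine (nP P) (MP P)) (nP P : ℂ))ᴴ))
          : Matrix (Tor (fine (nP P) (MP P)) × Fin P.d) (Tor (fine (nP P) (MP P)) × Fin P.d) ℂ) i j‖ ≤ ab / (nP P : ℝ) := by
  have ha : (0 : ℝ) < 1 := one_pos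
  have hL1 : (1 : ℝ) < L := by exact_mod_cast hL.2
  have hbm : 0 < 1 * (1 - ((L : ℝ) ^ 2)⁻¹) := by
    have : ((L : ℝ) ^ 2)⁻¹ < 1 := inv_lt_one_of_one_lt₀ (by nlinarith)
    linarith
  obtain ⟨C₁, hC₁, hG⟩ := exists_rowSum_towerG (d + 1) L (Nat.succ_pos d) hL ha
  obtain ⟨C₂, hC₂, hGD⟩ := exists_rowSum_towerG_derivT (d + 1) L (Nat.succ_pos d) hL ha
  obtain ⟨κ, c, hκ, hc, hCC⟩ := exists_rowSum_QGGQ_inv_le (d := d) (1 * (1 - ((L : ℝ) ^ 2)⁻¹)) 1 hbm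
  -- the constants
  set cC : ℝ := c⁻¹ * periodConst κ d * latticeConst (d + 1) (κ / (d + 1)) with hcC
  set cD : ℝ := (((d + 1 : ℕ) : ℕ) : ℝ) * C₂ with hcD
  set g : ℝ := cD + C₁ * (cC * C₁ * cD) with hg
  set Cφ : ℝ := 1260 * (48 : ℝ) ^ (d + 1) with hCφ
  set φ₃c : ℝ := (((d + 1 : ℕ) : ℕ) : ℝ) * (Cφ ^ 3 * ((2 / 3 : ℝ) ^ (-(1 / 2 : ℝ))) ^ 3 * Real.Gamma (1 / 2)) with hφ₃c
  refine ⟨φ₃c + Cφ ^ 2 * (cC * C₁ * cD + (2 + 1) * g + (1 + 1) * (C₁ * g)), fun P => ?_⟩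
  obtain ⟨Pd, PL, Pm, PK, Phd, PhL⟩ := P
  intro hPd hPL hK
  simp only at hPd hPL hK
  subst Pd
  subst PL
  set P : Params := ⟨d + 1, L, Pm, PK, Phd, PhL⟩ with hP
  intro ν i
  -- the running constant of the top step and its range
  have hb : 0 < α P 1 P.K := by rw [α_top]; exact ScalarTowerBridge.aSeq_top_pos P ha hK
  have hb1 : 1 * (1 - ((L : ℝ) ^ 2)⁻¹) ≤ α P 1 P.K := by rw [α_top]; exact (aSeq_bounds P ha hK).1
  have hb2 : α P 1 P.K ≤ 1 := by rw [α_top]; exact (aSeq_bounds P ha hK).2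
  obtain ⟨hG1, hG2⟩ := hG P rfl rfl hK
  have hGD' := hGD P rfl rfl hK
  -- the three scalar letters on b05's torus (file 7 §3 transfer)
  have hG' : ∀ z, ∑ z', ‖(LapS (fine (nP P) (MP P)) (nP P : ℂ) + ((α P 1 P.K : ℝ) : ℂ) • (QsAdj (nP P) (MP P) * QsOp (nP P) (MP P)))⁻¹ z z'‖ ≤ C₁ := by
    intro z
    obtain ⟨x, rfl⟩ : ∃ x, eFine P x = z := ⟨(eFine P).symm z, (eFine P).apply_symm_apply z⟩
    rw [rowSum_Gp_eq P ha hK]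
    exact hG1 x
  have hD : ∀ z, ∑ j, ‖((LapS (fine (nP P) (MP P)) (nP P : ℂ) + ((α P 1 P.K : ℝ) : ℂ) • (QsAdj (nP P) (MP P) * QsOp (nP P) (MP P)))⁻¹
      * (GradOp (fine (nP P) (MP P)) (nP P : ℂ))ᴴ) z j‖ ≤ cD := by
    intro z
    obtain ⟨x, rfl⟩ : ∃ x, eFine P x = z := ⟨(eFine P).symm z, (eFine P).apply_symm_apply z⟩
    rw [rowSum_Gp_GradOpH_eq P ha hK]
    calc ∑ ν : Fin P.d, ∑ x', |((tower P 1 0).G P.K * (deriv P 0 P.eps ν)ᵀ) x x'| ≤ ∑ _ν : Fin P.d, C₂ :=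
          Finset.sum_le_sum fun ν _ => hGD' ν x
      _ = cD := by simp [hP, hcD]
  have hC : ∀ y, ∑ y', ‖(QsOp (nP P) (MP P) * (LapS (fine (nP P) (MP P)) (nP P : ℂ) + ((α P 1 P.K : ℝ) : ℂ) • (QsAdj (nP P) (MP P) * QsOp (nP P) (MP P)))⁻¹
      * (LapS (fine (nP P) (MP P)) (nP P : ℂ) + ((α P 1 P.K : ℝ) : ℂ) • (QsAdj (nP P) (MP P) * QsOp (nP P) (MP P)))⁻¹ * QsAdj (nP P) (MP P))⁻¹ y y'‖ ≤ cC :=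
    hCC (nP P) (one_le_nP P) (MP P) (α P 1 P.K) hb1 hb2
  -- the two FREE letters on the cubic torus `Tor (fine (L^K) (2L^m)) = Tor (fun _ ↦ L^K·2L^m)`
  haveI : NeZero (nP P * (2 * L ^ Pm)) :=
    ⟨Nat.mul_ne_zero (by have := one_le_nP P; omega) (Nat.mul_ne_zero two_ne_zero (pow_ne_zero _ (by have := hL.2; omega)))⟩
  have hφ2 : ∀ i : Tor (fine (nP P) (MP P)) × Fin P.d, ∑ x, ‖((shiftM (fine (nP P) (MP P)) ν - 1) * GradOp (fine (nP P) (MP P)) (nP P : ℂ)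
      * ((LapS (fine (nP P) (MP P)) (nP P : ℂ) + 1)⁻¹ * (LapS (fine (nP P) (MP P)) (nP P : ℂ) + 1)⁻¹)
        : Matrix (Tor (fine (nP P) (MP P)) × Fin P.d) (Tor (fine (nP P) (MP P))) ℂ) i x‖ ≤ Cφ ^ 2 / (nP P) :=
    fun i => rowSum_shift_grad_biResolvent_le (D := d + 1) (nP P * (2 * L ^ Pm)) (nP P) ν i
  have hφ3 : ∀ i : Tor (fine (nP P) (MP P)) × Fin P.d, ∑ j, ‖((shiftM (fine (nP P) (MP P)) ν - 1) * GradOp (fine (nP P) (MP P)) (nP P : ℂ)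
      * ((LapS (fine (nP P) (MP P)) (nP P : ℂ) + 1)⁻¹ * (LapS (fine (nP P) (MP P)) (nP P : ℂ) + 1)⁻¹) * (GradOp (fine (nP P) (MP P)) (nP P : ℂ))ᴴ
        : Matrix (Tor (fine (nP P) (MP P)) × Fin P.d) (Tor (fine (nP P) (MP P)) × Fin P.d) ℂ) i j‖ ≤ φ₃c / (nP P) :=
    fun i => rowSum_shift_grad_biResolvent_gradH_le (D := d + 1) (nP P * (2 * L ^ Pm)) (nP P) ν i
  -- FILE A's socket
  have hmain := rowSum_shift_gaugeFactor_le (nP P) (MP P) hb ν hφ3 hφ2 hG' hC hD i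
  -- monotonicity in `b ≤ 1`
  have hn : (0 : ℝ) < (nP P : ℝ) := by exact_mod_cast one_le_nP P
  have hcC0 : 0 ≤ cC := rowSum_nonneg_of_le (Classical.arbitrary _) (hC (Classical.arbitrary _))
  have hcD0 : 0 ≤ cD := by rw [hcD]; positivity
  have hg0 : 0 ≤ g := by rw [hg]; positivity
  have hφ2c0 : 0 ≤ Cφ ^ 2 / (nP P) := by positivity
  calc _ ≤ φ₃c / (nP P) + Cφ ^ 2 / (nP P) * (cC * C₁ * cD + (2 + α P 1 P.K) * g + (1 + α P 1 P.K) * (C₁ * g)) := hmain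
    _ ≤ φ₃c / (nP P) + Cφ ^ 2 / (nP P) * (cC * C₁ * cD + (2 + 1) * g + (1 + 1) * (C₁ * g)) := by
        gcongr
    _ = (φ₃c + Cφ ^ 2 * (cC * C₁ * cD + (2 + 1) * g + (1 + 1) * (C₁ * g))) / (nP P : ℝ) := by
        field_simp

/-! ## §2 `d = 3`: the (T1′) socket closed — (T1′), `hR1′`, `hR2` of the (R1) gauge term are unconditional -/

variable {Lc : ℕ} [NeZero Lc]

/-- [our proof] **(T1′) — THE COLUMN-DIFFERENCE Γ-LETTER OF THE PERFECT ff BLOCK IS A THEOREM** (RHOA-3's `hT1` shape, `T₁ ≍ n`): for odd `Lc > 1`,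
`∃ A₁ ∀ m ≥ 1 ∀ w μ κ l Q, Σ_{q∈Q}|KPerf Lc … m q (w+e_μ) (inl κ)(inl l) − KPerf … m q w (inl κ)(inl l)| ≤ A₁·Lc^m` (F5e's END + §1). -/
theorem sum_abs_KPerf_ff_colDiff_le (hLc : Odd Lc ∧ 1 < Lc) :
    ∃ A₁ : ℝ, ∀ m : ℕ, 1 ≤ m → ∀ (w : AffineAveraging.Site (3 + 1)) (μ κ l : Fin (3 + 1)) (Q : Finset (AffineAveraging.Site (3 + 1))),
      ∑ q ∈ Q, |KPerf (d := 3) Lc (sfStep Lc) (smStep 3 Lc) m q (w + AffineAveraging.unitVec μ) (Sum.inl κ) (Sum.inl l)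
          - KPerf (d := 3) Lc (sfStep Lc) (smStep 3 Lc) m q w (Sum.inl κ) (Sum.inl l)| ≤ A₁ * (Lc : ℝ) ^ m := by
  obtain ⟨ab, hAB⟩ := gaugeLetter_holds 3 Lc hLc
  exact sum_abs_KPerf_ff_colDiff_le_of_gaugeLetter hLc hAB

/-- [our proof] **`hR1′` OF THE (R1) GAUGE TERM — UNCONDITIONAL**: `∃ B₁′ ∀ m ≥ 1 ∀ μ ν l j p w, |ρ p (w+e_j) − ρ p w| ≤ B₁′∕((Lc)^m)³`. -/
theorem exists_abs_rho_road_sub_right_le (hLc : Odd Lc ∧ 1 < Lc) :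
    ∃ B₁' : ℝ, ∀ m : ℕ, 1 ≤ m → ∀ (μ ν l j : Fin 4) (p w : Pt),
      |(∑' xq : Pt × Pt, (latticeGreen (p - xq.1 + Pi.single μ 1) / 2 - latticeGreen (p - xq.1) / 2)
            * (piC (d := 3) (Lc ^ m) xq.1 (xq.2 + AffineAveraging.unitVec ν) - piC (d := 3) (Lc ^ m) xq.1 xq.2).re
            * KPerf (d := 3) Lc (sfStep Lc) (smStep 3 Lc) m xq.2 (w + AffineAveraging.unitVec j) (Sum.inl ν) (Sum.inl l))
          - ∑' xq : Pt × Pt, (latticeGreen (p - xq.1 + Pi.single μ 1) / 2 - latticeGreen (p - xq.1) / 2)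
            * (piC (d := 3) (Lc ^ m) xq.1 (xq.2 + AffineAveraging.unitVec ν) - piC (d := 3) (Lc ^ m) xq.1 xq.2).re
            * KPerf (d := 3) Lc (sfStep Lc) (smStep 3 Lc) m xq.2 w (Sum.inl ν) (Sum.inl l)|
        ≤ B₁' / ((Lc : ℝ) ^ m) ^ 3 := by
  obtain ⟨ab, hAB⟩ := gaugeLetter_holds 3 Lc hLc
  exact exists_abs_rho_road_sub_right_le_of_gaugeLetter hLc hAB

/-- [our proof] **`hR2` OF THE (R1) GAUGE TERM — UNCONDITIONAL**: `∃ B₂ ∀ m ≥ 1 ∀ μ ν l i j p w,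
|ρ (p+e_i) (w+e_j) − ρ p (w+e_j) − ρ (p+e_i) w + ρ p w| ≤ B₂∕((Lc)^m)⁴`. -/
theorem exists_abs_rho_road_sub_sub_le (hLc : Odd Lc ∧ 1 < Lc) :
    ∃ B₂ : ℝ, ∀ m : ℕ, 1 ≤ m → ∀ (μ ν l i j : Fin 4) (p w : Pt),
      |(∑' xq : Pt × Pt, (latticeGreen (p + AffineAveraging.unitVec i - xq.1 + Pi.single μ 1) / 2
              - latticeGreen (p + AffineAveraging.unitVec i - xq.1) / 2)
            * (piC (d := 3) (Lc ^ m) xq.1 (xq.2 + AffineAveraging.unitVec ν) - piC (d := 3) (Lc ^ m) xq.1 xq.2).re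
            * KPerf (d := 3) Lc (sfStep Lc) (smStep 3 Lc) m xq.2 (w + AffineAveraging.unitVec j) (Sum.inl ν) (Sum.inl l))
          - (∑' xq : Pt × Pt, (latticeGreen (p - xq.1 + Pi.single μ 1) / 2 - latticeGreen (p - xq.1) / 2)
            * (piC (d := 3) (Lc ^ m) xq.1 (xq.2 + AffineAveraging.unitVec ν) - piC (d := 3) (Lc ^ m) xq.1 xq.2).re
            * KPerf (d := 3) Lc (sfStep Lc) (smStep 3 Lc) m xq.2 (w + AffineAveraging.unitVec j) (Sum.inl ν) (Sum.inl l))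
          - (∑' xq : Pt × Pt, (latticeGreen (p + AffineAveraging.unitVec i - xq.1 + Pi.single μ 1) / 2
              - latticeGreen (p + AffineAveraging.unitVec i - xq.1) / 2)
            * (piC (d := 3) (Lc ^ m) xq.1 (xq.2 + AffineAveraging.unitVec ν) - piC (d := 3) (Lc ^ m) xq.1 xq.2).re
            * KPerf (d := 3) Lc (sfStep Lc) (smStep 3 Lc) m xq.2 w (Sum.inl ν) (Sum.inl l))
          + ∑' xq : Pt × Pt, (latticeGreen (p - xq.1 + Pi.single μ 1) / 2 - latticeGreen (p - xq.1) / 2)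
            * (piC (d := 3) (Lc ^ m) xq.1 (xq.2 + AffineAveraging.unitVec ν) - piC (d := 3) (Lc ^ m) xq.1 xq.2).re
            * KPerf (d := 3) Lc (sfStep Lc) (smStep 3 Lc) m xq.2 w (Sum.inl ν) (Sum.inl l)|
        ≤ B₂ / ((Lc : ℝ) ^ m) ^ 4 := by
  obtain ⟨ab, hAB⟩ := gaugeLetter_holds 3 Lc hLc
  exact exists_abs_rho_road_sub_sub_le_of_gaugeLetter hLc hAB

end Summit.QuantumFields.BalabanUV.Beta.FP.CovarianceRowDiffGauge

end
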